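/-
COR-CM (cell pub-hodgecm2, stage 2 of the Hodge ladder) — count-neutral KERNEL COMBINATORICS «exactly 8 / 25 / 19 faces for the Galois CM fields with
group S₃ × C₂ / D₄ × C₂ / Q₈ × C₂» (seat prover-pub-hodgecm2-b23-g40-0, binder prover b23, gen 40; claim COMPLEMENT-FACES F11, HOME/INBOX.md
l.9766/l.9940; sequel of `CorCM/FaceComplementGeneration.lean` and `Census/ComplementFacesNumerals.lean`).  Theorems only; no geometry beyond the
tree's `Face`, no `Universe` field touched, no named fact, nothing asserted; `Interfaces.lean` (C1), every E term, B01 and `Transposition/*` are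
untouched.
HONEST FRAMING (COORDINATOR RULING — HODGE FRAMING CORRECTION, 2026-08-21T11:55:35Z): `HC_CM` is NOT proved, here or anywhere in the tree;
this file produces no period and proves no face period for any field; its one `HodgeConjectureFor` statement is CONDITIONAL on face periods.
T5: n/a-class — binders: a complement of `conjT` with an isomorphism to a named group (data) and INT2-GEN's period hypothesis (§2); no named-fact /
conjecture-def binder; checker: self (prover-pub-hodgecm2-b23-g40-0), 2026-08-23.
-/
import Summits.HodgeConjecture.CorCM.FaceComplementGeneration
import Summits.HodgeConjecture.CorCM.Census.ComplementFacesNumerals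
import HarnessLib

/-!
# Galois CM fields with group `S₃ × C₂`, `D₄ × C₂`, `Q₈ × C₂`: EXACTLY `8`, `25`, `19` generating rank-four faces

For a Galois CM field `F` whose complex conjugation has a complement `A ≤ GalT F` (`P ∈ A ↔ conjT·P ∉ A`; `A ≅ Gal(F/E) ≅ Gal(F⁺/ℚ)` for the
imaginary quadratic subfield `E`, `CorCM/FaceComplementImaginaryQuadratic.lean`) isomorphic to
* `DihedralGroup 3 ≅ S₃` — `Gal(F/ℚ) ≅ S₃ × C₂ = D₆`, the Galois closures `k·F̃₀` of the sextic CM fields `k·F₀` with `F₀` a NON-Galois totally real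
  cubic (the commonest sextic CM fields): `β(F) = 10` and the least size of a face set `𝒮` with `hgen(𝒮, σ₀)` is **exactly `8`**
  (`isLeast_card_faces_hgen_of_cpl_dihedral_three`) — the `8` faces of the census certificate `Census/DuodecicFaceTransportDihedral*.lean`
  (seat b23 gen 33, kit job j137010) are now provably the least possible, census-free;
* `DihedralGroup 4` — `Gal(F/ℚ) ≅ D₄ × C₂` (degree 16): `β(F) = 27`, **exactly `25`** faces;
* `QuaternionGroup 2 = Q₈` — `Gal(F/ℚ) ≅ Q₈ × C₂` (degree 16): `β(F) = 21`, **exactly `19`** faces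
(seat b09 gen 31's censused rows, now theorems).  §2: the conditional HC reading for the `D₆` fields with `8` face periods.  `HC_CM` is NOT proved.

References: [cite: Pohlmann1968, Thm. 1]; [cite: Milne1999LefschetzClasses, Thm. 3.2, Prop. 2.1]; [cite: Shimura1998, §6.2 Theorem 3 and §6.1
Corollary of Theorem 2 (pp. 41–43)]; [cite: MumfordAV1970, §19 Thm. 1 and p. 169].
-/

noncomputable section

open CategoryTheory NumberField NumberField.ComplexEmbedding
open Literature.AlgebraicGeometry Literature.AlgebraicGeometry.Motives Literature.AlgebraicGeometry.HodgeTheory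
open Literature.AlgebraicGeometry.ComplexMultiplication Literature.AlgebraicGeometry.Milne1999
open Literature.NumberTheory.Automorphic
open Literature.NumberTheory.Automorphic.PicardCM
open Summit.HodgeConjecture.CorCM.Domination

namespace Summit.HodgeConjecture.CorCM.FaceComplement

open Summit.HodgeConjecture.CorCM.Prior.AllgGroup.RfwfAllgGroup
open Summit.HodgeConjecture.CorCM.Census.BlockParity
open Summit.HodgeConjecture.CorCM.Census.Coinvariant

/-! ## §1 The three named complements -/

section Field

variable {F : Type} [Field F] [NumberField F]

/-- The half-degree of a Galois CM field with a complement `A ≃* A₀` is `|A₀|`. [folklore] -/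
theorem finrank_div_two_eq_card_of_cpl_equiv [IsCMField F] [IsGalois ℚ F] {A : Subgroup (GalT F)}
    (hA : ∀ P : GalT F, P ∈ A ↔ conjT * P ∉ A) {A₀ : Type*} [Group A₀] [Fintype A₀] (e : A ≃* A₀) :
    Module.finrank ℚ F / 2 = Fintype.card A₀ := by
  rw [← FaceCensus.card_galT, Census.ComplementFaces.card_eq_two_mul_of_cpl_equiv conjT hA conjT_mul_self e,
    Nat.mul_div_cancel_left _ (by norm_num : 0 < 2)]

/-- **`Gal(F/ℚ) ≅ S₃ × C₂` (complement `≅ D₃`): `β(F) = 10` and EXACTLY `8` generating faces, none fewer.**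
[cite: Pohlmann1968, Thm. 1] [cite: Milne1999LefschetzClasses, Thm. 3.2, Prop. 2.1] -/
theorem isLeast_card_faces_hgen_of_cpl_dihedral_three [IsCMField F] [IsGalois ℚ F] {A : Subgroup (GalT F)}
    (hA : ∀ P : GalT F, P ∈ A ↔ conjT * P ∉ A) (e : A ≃* DihedralGroup 3) (σ₀ : F →+* ℂ) :
    Fintype.card (Block (conjT : GalT F)) = 10 ∧
    IsLeast {m : ℕ | ∃ 𝒮 : Finset (Face F), 𝒮.card = m ∧
      ∀ f : Face F, lefChar f.corner (fun _ => ({σ₀} : Finset (F →+* ℂ))) ∈ AddSubgroup.closure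
        {a : Asym F | ∃ g ∈ (𝒮 : Set (Face F)), ∃ σ : F →+* ℂ, a = lefChar g.corner (fun _ => ({σ} : Finset (F →+* ℂ)))}} 8 := by
  have hβ := Census.ComplementFaces.card_block_of_cpl_dihedral_three conjT hA conjT_mul_self (fun P => FaceBasis.conjT_comm P) e
  have heven : Even (Module.finrank ℚ F / 2) := by
    rw [finrank_div_two_eq_card_of_cpl_equiv hA e, DihedralGroup.card]; decide
  have h := isLeast_card_faces_hgen_of_cpl_even hA heven σ₀
  rw [hβ] at h
  exact ⟨hβ, h⟩

/-- **`Gal(F/ℚ) ≅ D₄ × C₂` (complement `≅ D₄`): `β(F) = 27` and EXACTLY `25` generating faces, none fewer.**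
[cite: Pohlmann1968, Thm. 1] [cite: Milne1999LefschetzClasses, Thm. 3.2, Prop. 2.1] -/
theorem isLeast_card_faces_hgen_of_cpl_dihedral_four [IsCMField F] [IsGalois ℚ F] {A : Subgroup (GalT F)}
    (hA : ∀ P : GalT F, P ∈ A ↔ conjT * P ∉ A) (e : A ≃* DihedralGroup 4) (σ₀ : F →+* ℂ) :
    Fintype.card (Block (conjT : GalT F)) = 27 ∧
    IsLeast {m : ℕ | ∃ 𝒮 : Finset (Face F), 𝒮.card = m ∧
      ∀ f : Face F, lefChar f.corner (fun _ => ({σ₀} : Finset (F →+* ℂ))) ∈ AddSubgroup.closure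
        {a : Asym F | ∃ g ∈ (𝒮 : Set (Face F)), ∃ σ : F →+* ℂ, a = lefChar g.corner (fun _ => ({σ} : Finset (F →+* ℂ)))}} 25 := by
  have hβ := Census.ComplementFaces.card_block_of_cpl_dihedral_four conjT hA conjT_mul_self (fun P => FaceBasis.conjT_comm P) e
  have heven : Even (Module.finrank ℚ F / 2) := by
    rw [finrank_div_two_eq_card_of_cpl_equiv hA e, DihedralGroup.card]; decide
  have h := isLeast_card_faces_hgen_of_cpl_even hA heven σ₀
  rw [hβ] at h
  exact ⟨hβ, h⟩

/-- **`Gal(F/ℚ) ≅ Q₈ × C₂` (complement `≅ Q₈`): `β(F) = 21` and EXACTLY `19` generating faces, none fewer.**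
[cite: Pohlmann1968, Thm. 1] [cite: Milne1999LefschetzClasses, Thm. 3.2, Prop. 2.1] -/
theorem isLeast_card_faces_hgen_of_cpl_quaternion [IsCMField F] [IsGalois ℚ F] {A : Subgroup (GalT F)}
    (hA : ∀ P : GalT F, P ∈ A ↔ conjT * P ∉ A) (e : A ≃* QuaternionGroup 2) (σ₀ : F →+* ℂ) :
    Fintype.card (Block (conjT : GalT F)) = 21 ∧
    IsLeast {m : ℕ | ∃ 𝒮 : Finset (Face F), 𝒮.card = m ∧
      ∀ f : Face F, lefChar f.corner (fun _ => ({σ₀} : Finset (F →+* ℂ))) ∈ AddSubgroup.closure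
        {a : Asym F | ∃ g ∈ (𝒮 : Set (Face F)), ∃ σ : F →+* ℂ, a = lefChar g.corner (fun _ => ({σ} : Finset (F →+* ℂ)))}} 19 := by
  have hβ := Census.ComplementFaces.card_block_of_cpl_quaternion conjT hA conjT_mul_self (fun P => FaceBasis.conjT_comm P) e
  have heven : Even (Module.finrank ℚ F / 2) := by
    rw [finrank_div_two_eq_card_of_cpl_equiv hA e, QuaternionGroup.card]; decide
  have h := isLeast_card_faces_hgen_of_cpl_even hA heven σ₀
  rw [hβ] at h
  exact ⟨hβ, h⟩

end Field

/-! ## §2 The Hodge-conjecture reading for the `D₆` fields (conditional on 8 face periods) -/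

/-- **HC for the slice of a Galois CM field with group `S₃ × C₂ = D₆` from EIGHT face periods** (INT2-GEN socket BY NAME; CONDITIONAL on the
periods — `HC_CM` is NOT proved): for `K` Galois CM with a complement `A ≅ S₃` of complex conjugation there is a set `𝒮` of exactly `8` rank-four
faces (the least possible) such that ONE period witness per face of `𝒮` on the universe of record implies the Hodge conjecture for every abelian
variety dominated by a product of CM abelian varieties with CM by subfields of `K` — in particular for the sextic CM fields `k·F₀` inside `K`.
[cite: Shimura1998, §6.2 Theorem 3 and §6.1 Corollary of Theorem 2 (pp. 41–43)] [cite: Pohlmann1968, Thm. 1]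
[cite: Milne1999LefschetzClasses, Thm. 3.2 and Cor. 4.5] [cite: MumfordAV1970, §19 Thm. 1 and p. 169] -/
theorem hodgeConjectureFor_of_cpl_dihedral_three_of_exists_facePeriod (K : CMField) [hGal : IsGalois ℚ K] {A : Subgroup (GalT K)}
    (hA : ∀ P : GalT K, P ∈ A ↔ conjT * P ∉ A) (e : A ≃* DihedralGroup 3) (σ₀ : (K : Type) →+* ℂ) :
    ∃ 𝒮 : Finset (Face K), 𝒮.card = 8 ∧
      ((∀ f ∈ 𝒮, ∃ ι₁ : K →+* ℂ, f.Admissible ι₁ ∧ ∃ (V : HermSpace3 K ι₁) (σ : K →+* ℂ),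
        (Model.picardCMUniverse exists_isReal_hodgeModel_holds hodgePQ_independent_of_hodgeModel_holds
          BallQuotient.ballQuotientUniformised_holds cmAbelianVarietyRealised_holds).PeriodNV ι₁ V K f.psi σ) →
      ∀ {P B : AbelianVariety ℂ}, AbelianVariety.IsProductOf (fun B : AbelianVariety ℂ =>
        ∃ (E : Type) (_ : Field E) (_ : NumberField E) (_ : IsCMField E) (_ : E →+* (K : Type)) (Φ : CMType E)
          (ι : 𝓞 E →+* End B) (θ : E →+* Module.End ℂ (complexBetti B.X 1)),
          IsCMTypeRealisation Φ B ι θ) P →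
      AVDominatedBy B P → HodgeConjectureFor B.dim B.X) := by
  have h12 : Module.finrank ℚ (K : Type) = 12 := by
    have h := finrank_div_two_eq_card_of_cpl_equiv (F := K) hA e
    rw [DihedralGroup.card] at h
    have h2 : 2 ∣ Module.finrank ℚ (K : Type) := by
      rw [← FaceCensus.card_galT, Census.ComplementFaces.card_eq_two_mul_of_cpl_equiv conjT hA conjT_mul_self e]
      exact dvd_mul_right 2 _
    omega
  obtain ⟨⟨𝒮, hcard, hgen⟩, -⟩ := (isLeast_card_faces_hgen_of_cpl_dihedral_three (F := K) hA e σ₀).2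
  refine ⟨𝒮, hcard, fun h P B hP hB => ?_⟩
  exact hodgeConjectureFor_of_avDominatedBy_isProductOf_of_exists_facePeriod_on K (by omega) (𝒮 : Set (Face K)) σ₀ hgen
    (fun f hf => h f (Finset.mem_coe.mp hf)) hP hB

end Summit.HodgeConjecture.CorCM.FaceComplement

end
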